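import Literature.NumberTheory.Automorphic.UnitaryGroupRankOneIwahoriDatum          -- ★ (F0P3-p01) `K_γ ∩ U` Iwahori factorisation `coe_comap_congruenceGL_eq_mul`, `nbar_mul_torus_mul_unipotent_inj`, `w₀` bookkeeping; brings `congruenceGL`, `borelTriple`
import Literature.NumberTheory.Automorphic.UnitaryGroupHeisenbergRingRegularTwist    -- ★ HeisRing: `heisX_inv`, `coe_heisY_inv`, `heisX_mul`, `coe_heisY_mul`, Haar module `map_torusConj_mul_inv_eq_smul`, `continuous_torusConj_mul_inv`
import Summits.HodgeConjecture.HodgeConjecture.Theorems.F0P3cStCharTSVanDijkBox      -- ★ p851676 (LH6-p03 g5) (J3) `bijOn_vanDijk_box`, `injOn_vanDijk`; brings ★ TN-CONJ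
import HarnessLib

/-!
# F0 · P3c · line LH6 «StCharTS» — ROAD «JAC-LOC» brick (J2) «LEVELS★»: the levels `K_γ ∩ U` of `U(σ, Φ₃)(K)` in the Heisenberg chart (boxes, `w₀`-twin, Iwahori bijection, Haar of a twisted box)

Cell `pub/hodgecm-mathlib`, crux H413 = `stmt-HodgeConjecture-24833` (lane `--supports … --as helper`); seat F0P3-p02 (g21); ROAD «JAC-LOC» (holder LH6-p03 (g5), memo
`F0/P3b/LH6-p03/g5/ROAD-JAC-LOC.v2.LH6p03g5.md` §2 (J2) ∕ §5) towards the HYPERBOLIC half of the print residue «WIF» [Rogawski1990 §12.5 p. 182] of the (S-𝔇) organ.  THEOREMS ONLY;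
★-only imports.  HONEST LABEL: HC_CM is proved only modulo the 7 printed citations (2 remaining: hLiu418 = `stmt-HodgeConjecture-24832`, h413 = `stmt-HodgeConjecture-24833`) until rung 0
closes; count-neutral.  SETTING (the MODEL of ★ `UnitaryGroupRankOneIwahoriDatum`): `K` field, `[ValuativeRel K]`, `v = valuation K`, `σ` an ISOMETRIC involution (`hσ`, `hσv`),
`[Invertible (2 : K)]`, `J = Φ₃`, `N = unipotentU σ J` with the chart `(heisX, heisY)` of ★ `UnitaryGroupHeisenbergRing`, `T = torusU σ J`, `N̄ = w₀ N w₀`, `K_γ := (congruenceGL 3 γ).comap U.subtype`;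
§4 over a valued ring `(R, v)` as ★ (J3); §5 over the topological ring of ★ `UnitaryGroupHeisenbergRingRegularTwist`'s Haar section.
§1 chart matrix + valuation bounds · §2 (L1) `mem_level_iff_of_mem_unipotentU`, (L3) `mem_level_iff_of_eq_glDiagonal`, (L2) `mem_level_inf_Nbar_iff` · §3 (L4) `nbar_torus_unipotent_unique`,
`bijOn_iwahori_level`, `existsUnique_iwahori_level`, `mem_level_of_nbar_torus_unipotent_mem` · §4 (L6) `exists_subgroup_box` · §5 (L7) `measure_image_vanDijk`, `measure_vanDijk_box`, `measurableSet_box`.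

## References
* [Casselman1995] W. Casselman, *Introduction to the theory of admissible representations of p-adic reductive groups* (1995), Prop. 1.4.4.
* [BruhatTits1972] F. Bruhat, J. Tits, *Groupes réductifs sur un corps local I*, Publ. IHÉS 41 (1972), (4.4.3)–(4.4.4).
* [vanDijk1972] G. van Dijk, *Computation of certain induced characters of p-adic groups*, Math. Ann. 199 (1972), §2.
* [HarishChandra1970] Harish-Chandra (notes by G. van Dijk), LNM 162 (1970), Lemma 22.  [Rogawski1990] J. D. Rogawski, Ann. of Math. Stud. 123 (1990), §1.10 p. 9, §12.5 p. 182.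
-/
set_option autoImplicit false
-- the mandated namespace has the single-problem summit's repeated segment (`HodgeConjecture.HodgeConjecture`)
set_option linter.dupNamespace false
noncomputable section
open Matrix ValuativeRel MeasureTheory
open scoped MatrixGroups NNReal ENNReal
open Literature.NumberTheory.Automorphic Literature.NumberTheory.Automorphic.UnitaryGroup Literature.NumberTheory.Automorphic.UnitaryGroup.HeisRing
open Literature.NumberTheory.Rogawski1990
open Summit.HodgeConjecture.HodgeConjecture.Cruxes.H413.F0P3cStCharTSTorusUnipotentConj
open Summit.HodgeConjecture.HodgeConjecture.Cruxes.H413.F0P3cStCharTSVanDijkBox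

namespace Summit.HodgeConjecture.HodgeConjecture.Cruxes.H413.F0P3cStCharTSLevelBoxes
/-! ## §1 The chart matrix and its valuation bounds -/
section Chart
variable {K : Type*} [Field K] [ValuativeRel K] (σ : K →+* K) (hσ : ∀ x, σ (σ x) = x) [Invertible (2 : K)]
  {J : Matrix (Fin 3) (Fin 3) K} (hJ : J = (StdForm.antidiagonal 3).over K)
  (hσv : ∀ x, valuation K (σ x) = valuation K x)

include hσv in
/-- `v(z) ≤ γ` for `z = y − ½ x σx` when `v(x) ≤ γ`, `v(y) ≤ γ` and `v(½)·γ ≤ 1` (ultrametric inequality; `σ` isometric). [cite: Casselman1995, Prop. 1.4.4] -/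
theorem valuation_heisZ_le {γ : ValueGroupWithZero K} (h2 : valuation K (⅟(2 : K)) * γ ≤ 1) {x y : K}
    (hx : valuation K x ≤ γ) (hy : valuation K y ≤ γ) : valuation K (heisZ σ x y) ≤ γ := by
  unfold heisZ
  refine le_trans (Valuation.map_sub _ _ _) (max_le hy ?_)
  rw [map_mul, map_mul, hσv]
  calc valuation K (⅟(2 : K)) * (valuation K x * valuation K x) ≤ valuation K (⅟(2 : K)) * (γ * γ) :=
        mul_le_mul' le_rfl (mul_le_mul' hx hx)
    _ = (valuation K (⅟(2 : K)) * γ) * γ := by rw [mul_assoc]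
    _ ≤ 1 * γ := mul_le_mul' h2 le_rfl
    _ = γ := one_mul γ

include hσv in
/-- Conversely `v(y) ≤ γ` from `v(x) ≤ γ`, `v(z) ≤ γ` (`y = z + ½ x σx`). [cite: Casselman1995, Prop. 1.4.4] -/
theorem valuation_le_of_heisZ_le {γ : ValueGroupWithZero K} (h2 : valuation K (⅟(2 : K)) * γ ≤ 1) {x y : K}
    (hx : valuation K x ≤ γ) (hz : valuation K (heisZ σ x y) ≤ γ) : valuation K y ≤ γ := by
  have hy : y = heisZ σ x y + ⅟(2 : K) * (x * σ x) := by unfold heisZ; ring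
  rw [hy]
  refine le_trans (Valuation.map_add _ _ _) (max_le hz ?_)
  rw [map_mul, map_mul, hσv]
  calc valuation K (⅟(2 : K)) * (valuation K x * valuation K x) ≤ valuation K (⅟(2 : K)) * (γ * γ) :=
        mul_le_mul' le_rfl (mul_le_mul' hx hx)
    _ = (valuation K (⅟(2 : K)) * γ) * γ := by rw [mul_assoc]
    _ ≤ 1 * γ := mul_le_mul' h2 le_rfl
    _ = γ := one_mul γ

include hσv in
/-- **`heisMatrix x y − 1 ≡ 0 (mod γ)`** when `v(x), v(z) ≤ γ` (its entries are `0, x, z, −σx`). [cite: Casselman1995, Prop. 1.4.4] -/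
theorem valBound_heisMatrix_sub_one {γ : ValueGroupWithZero K} {x y : K} (hx : valuation K x ≤ γ) (hz : valuation K (heisZ σ x y) ≤ γ) :
    ValBound γ (heisMatrix σ x y - 1) := by
  intro i j
  fin_cases i <;> fin_cases j <;>
    simp [heisMatrix, hx, hz, hσv]

include hσv in
/-- **`heisMatrix x y` is integral** when `v(x), v(z) ≤ 1`. [cite: Casselman1995, Prop. 1.4.4] -/
theorem valBound_one_heisMatrix {x y : K} (hx : valuation K x ≤ 1) (hz : valuation K (heisZ σ x y) ≤ 1) :
    ValBound 1 (heisMatrix σ x y) := by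
  intro i j
  fin_cases i <;> fin_cases j <;>
    simp [heisMatrix, hx, hz, hσv]

omit [ValuativeRel K] in
/-- **The matrix of `n ∈ N` is the chart matrix at its coordinates**: `n = [[1, x n, z], [0, 1, −σ(x n)], [0, 0, 1]]`, `z = y n − ½ x n σ(x n)` (★ `heisElt_heisX_heisY`).
[cite: Rogawski1990, §1.10 p. 9] -/
theorem coe_coe_eq_heisMatrix (n : ↥(unipotentU σ J)) :
    (((n : ↥(unitaryGroupOfForm σ J)) : GL (Fin 3) K) : Matrix (Fin 3) (Fin 3) K) = heisMatrix σ (heisX σ n) (heisY σ hσ hJ n : K) := by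
  conv_lhs => rw [← heisElt_heisX_heisY σ hσ hJ n]
  rfl
end Chart
/-! ## §2 (L1) `K_γ ∩ N`, (L3) `K_γ ∩ T`, (L2) `K_γ ∩ N̄` -/
section Levels
variable {K : Type*} [Field K] [ValuativeRel K] (σ : K →+* K) (hσ : ∀ x, σ (σ x) = x) [Invertible (2 : K)]
  {J : Matrix (Fin 3) (Fin 3) K} (hJ : J = (StdForm.antidiagonal 3).over K)
  (hσv : ∀ x, valuation K (σ x) = valuation K x)

include hσv in
/-- **(L1) `K_γ ∩ N` IS THE HEISENBERG BOX OF RADIUS `γ`.**  For a level `γ < 1` with `v(½)·γ ≤ 1` (no condition at odd residue characteristic) and `n ∈ N`: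
`n ∈ K_γ ↔ v(x n) ≤ γ ∧ v(y n) ≤ γ`.  (The entries of `n − 1` are `x, z, −σx` and those of `n⁻¹ − 1` are `−x, σz, σx`; `v(z) ≤ γ ↔ v(y) ≤ γ` given `v(x) ≤ γ`.)
[cite: Casselman1995, Prop. 1.4.4] [cite: Rogawski1990, §1.10 p. 9] -/
theorem mem_level_iff_of_mem_unipotentU {γ : ValueGroupWithZero K} (hγ : γ < 1) (h2 : valuation K (⅟(2 : K)) * γ ≤ 1) (n : ↥(unipotentU σ J)) :
    (n : ↥(unitaryGroupOfForm σ J)) ∈ (congruenceGL 3 γ).comap (unitaryGroupOfForm σ J).subtype ↔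
      valuation K (heisX σ n) ≤ γ ∧ valuation K (heisY σ hσ hJ n : K) ≤ γ := by
  rw [Subgroup.mem_comap, Subgroup.coe_subtype, mem_congruenceGL_iff]
  have hM := coe_coe_eq_heisMatrix σ hσ hJ n
  have hMi : ((((n : ↥(unitaryGroupOfForm σ J)) : GL (Fin 3) K)⁻¹ : GL (Fin 3) K) : Matrix (Fin 3) (Fin 3) K) =
      heisMatrix σ (heisX σ n⁻¹) (heisY σ hσ hJ n⁻¹ : K) := by
    rw [← coe_coe_eq_heisMatrix σ hσ hJ n⁻¹]; rfl
  constructor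
  · rintro ⟨-, h1, -⟩
    have hx : valuation K (heisX σ n) ≤ γ := by
      have h := h1 0 1
      rwa [hM, Matrix.sub_apply, Matrix.one_apply_ne (by decide), sub_zero] at h
    have hz : valuation K (heisZ σ (heisX σ n) (heisY σ hσ hJ n : K)) ≤ γ := by
      have h := h1 0 2
      rwa [hM, Matrix.sub_apply, Matrix.one_apply_ne (by decide), sub_zero] at h
    exact ⟨hx, valuation_le_of_heisZ_le σ hσv h2 hx hz⟩
  · rintro ⟨hx, hy⟩
    have hγ1 : γ ≤ 1 := hγ.le
    have hz := valuation_heisZ_le σ hσv h2 hx hy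
    have hx' : valuation K (heisX σ n⁻¹) ≤ γ := by rw [heisX_inv, Valuation.map_neg]; exact hx
    have hy' : valuation K (heisY σ hσ hJ n⁻¹ : K) ≤ γ := by rw [coe_heisY_inv, Valuation.map_neg]; exact hy
    have hz' := valuation_heisZ_le σ hσv h2 hx' hy'
    refine ⟨⟨?_, ?_⟩, ?_, ?_⟩
    · rw [hM]; exact valBound_one_heisMatrix σ hσv (hx.trans hγ1) (hz.trans hγ1)
    · rw [hMi]; exact valBound_one_heisMatrix σ hσv (hx'.trans hγ1) (hz'.trans hγ1)
    · rw [hM]; exact valBound_heisMatrix_sub_one σ hσv hx hz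
    · rw [hMi]; exact valBound_heisMatrix_sub_one σ hσv hx' hz'

omit [Invertible (2 : K)] in
/-- **(L3) `K_γ ∩ T` IS THE BOX `{diag(d) : v(d_i − 1) ≤ γ}`** (`γ < 1`; then `v(d_i) = 1` and `v(d_i⁻¹ − 1) = v(d_i − 1)`). [cite: Casselman1995, Prop. 1.4.4] -/
theorem mem_level_iff_of_eq_glDiagonal {γ : ValueGroupWithZero K} (hγ : γ < 1) {t : ↥(unitaryGroupOfForm σ J)} {d : Fin 3 → Kˣ}
    (hd : glDiagonal 3 K d = (t : GL (Fin 3) K)) :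
    t ∈ (congruenceGL 3 γ).comap (unitaryGroupOfForm σ J).subtype ↔ ∀ i, valuation K ((d i : K) - 1) ≤ γ := by
  rw [Subgroup.mem_comap, Subgroup.coe_subtype]
  constructor
  · intro h i
    obtain ⟨-, h2, -⟩ := mem_congruenceGL_iff.1 h
    have := h2 i i
    rwa [← hd, coe_glDiagonal, Matrix.sub_apply, Matrix.diagonal_apply_eq, Matrix.one_apply_eq] at this
  · intro h
    rw [← hd]
    -- `diag(d) ∈ K_γ` from the diagonal bounds: integrality from `v(d_i) = 1`, both congruences from `h`
    have hone : ∀ i, valuation K (d i : K) = 1 := fun i => by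
      have h' : (d i : K) = 1 + ((d i : K) - 1) := by ring
      rw [h', Valuation.map_add_eq_of_lt_left] <;> rw [Valuation.map_one]
      exact lt_of_le_of_lt (h i) hγ
    have hinv : ∀ i, valuation K ((d i : K)⁻¹ - 1) ≤ γ := fun i => by
      have h' : ((d i : K))⁻¹ - 1 = (d i : K)⁻¹ * (1 - (d i : K)) := by
        rw [mul_sub, mul_one, inv_mul_cancel₀ (d i).ne_zero]
      rw [h', Valuation.map_mul, map_inv₀, hone i, inv_one, one_mul, Valuation.map_sub_swap]
      exact h i
    refine mem_congruenceGL_iff.2 ⟨⟨fun i j => ?_, fun i j => ?_⟩, fun i j => ?_, fun i j => ?_⟩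
    · rw [coe_glDiagonal, Matrix.diagonal_apply]
      split_ifs
      · rw [hone]
      · rw [Valuation.map_zero]; exact zero_le
    · rw [← map_inv, coe_glDiagonal, Matrix.diagonal_apply]
      split_ifs
      · rw [Pi.inv_apply, Units.val_inv_eq_inv_val, map_inv₀, hone, inv_one]
      · rw [Valuation.map_zero]; exact zero_le
    · rw [coe_glDiagonal, Matrix.sub_apply, Matrix.diagonal_apply, Matrix.one_apply]
      split_ifs
      · exact h i
      · rw [sub_zero, Valuation.map_zero]; exact zero_le
    · rw [← map_inv, coe_glDiagonal, Matrix.sub_apply, Matrix.diagonal_apply, Matrix.one_apply]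
      split_ifs
      · rw [Pi.inv_apply, Units.val_inv_eq_inv_val]; exact hinv i
      · rw [sub_zero, Valuation.map_zero]; exact zero_le

omit [Invertible (2 : K)] in
/-- **(L2) `K_γ ∩ N̄ = w₀ (K_γ ∩ N) w₀`**: an element of `K_γ ∩ w₀Nw₀` is `w₀ n w₀` with `n ∈ K_γ ∩ N` and conversely (`w₀` normalises `K_γ`, `w₀² = 1`; ★
`weylLongU_mul_mul_weylLongU_mem_comap_congruenceGL`). [cite: Casselman1995, Prop. 1.4.4] [cite: Rogawski1990, §1.10 p. 9] -/
theorem mem_level_inf_Nbar_iff {γ : ValueGroupWithZero K} (x : ↥(unitaryGroupOfForm σ J)) :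
    x ∈ (congruenceGL 3 γ).comap (unitaryGroupOfForm σ J).subtype ⊓ ((borelTriple σ J hJ).N).map (MulAut.conj (weylLongU σ hJ)).toMonoidHom ↔
      ∃ n : ↥(unitaryGroupOfForm σ J), n ∈ (congruenceGL 3 γ).comap (unitaryGroupOfForm σ J).subtype ⊓ (borelTriple σ J hJ).N ∧
        x = weylLongU σ hJ * n * weylLongU σ hJ := by
  have hw1 : weylLongU σ hJ * weylLongU σ hJ = 1 := weylLongU_mul_weylLongU σ hJ
  have hwinv : (weylLongU σ hJ)⁻¹ = weylLongU σ hJ := (eq_inv_of_mul_eq_one_left hw1).symm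
  constructor
  · rintro ⟨hxK, hxN⟩
    obtain ⟨n, hn, hnx⟩ := Subgroup.mem_map.1 hxN
    have hnx' : x = weylLongU σ hJ * n * weylLongU σ hJ := by rw [← hnx, MulEquiv.coe_toMonoidHom, MulAut.conj_apply, hwinv]
    refine ⟨n, Subgroup.mem_inf.2 ⟨?_, hn⟩, hnx'⟩
    have : n = weylLongU σ hJ * x * weylLongU σ hJ := by
      rw [hnx']
      simp only [← mul_assoc, hw1, one_mul]
      rw [mul_assoc, hw1, mul_one]
    rw [this]
    exact weylLongU_mul_mul_weylLongU_mem_comap_congruenceGL σ hJ hxK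
  · rintro ⟨n, hn, rfl⟩
    obtain ⟨hnK, hnN⟩ := Subgroup.mem_inf.1 hn
    refine Subgroup.mem_inf.2 ⟨weylLongU_mul_mul_weylLongU_mem_comap_congruenceGL σ hJ hnK, Subgroup.mem_map.2 ⟨n, hnN, ?_⟩⟩
    rw [MulEquiv.coe_toMonoidHom, MulAut.conj_apply, hwinv]
end Levels
/-! ## §3 (L4) The Iwahori factorisation of `K_γ ∩ U` as a BIJECTION -/
section Iwahori
variable {K : Type*} [Field K] [ValuativeRel K] (σ : K →+* K) {J : Matrix (Fin 3) (Fin 3) K} (hJ : J = (StdForm.antidiagonal 3).over K)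

omit [ValuativeRel K] in
/-- The matrix of an element of `N̄ = w₀ N w₀` has unit diagonal. [cite: Rogawski1990, §1.10 p. 9] -/
theorem apply_diag_eq_one_of_mem_Nbar {x : ↥(unitaryGroupOfForm σ J)}
    (hx : x ∈ ((borelTriple σ J hJ).N).map (MulAut.conj (weylLongU σ hJ)).toMonoidHom) (i : Fin 3) :
    (((x : ↥(unitaryGroupOfForm σ J)) : GL (Fin 3) K) : Matrix (Fin 3) (Fin 3) K) i i = 1 := by
  obtain ⟨n, hn, hnx⟩ := Subgroup.mem_map.1 hx
  have hwinv : (weylLongU σ hJ)⁻¹ = weylLongU σ hJ := (eq_inv_of_mul_eq_one_left (weylLongU_mul_weylLongU σ hJ)).symm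
  have hnx' : x = weylLongU σ hJ * n * weylLongU σ hJ := by rw [← hnx, MulEquiv.coe_toMonoidHom, MulAut.conj_apply, hwinv]
  rw [borelTriple_N] at hn
  rw [hnx', coe_weylLongU_mul_mul_weylLongU_apply]
  exact ((mem_unipotentU_iff n).1 hn).2 _

omit [ValuativeRel K] in
/-- **Uniqueness of ALL THREE factors in `N̄ · T · N`**: if `n̄ m n = n̄′ m′ n′` with `n̄, n̄′ ∈ w₀Nw₀`, `m, m′ ∈ T`, `n, n′ ∈ N`, then `n̄ = n̄′`, `m = m′`, `n = n′`
(★ `nbar_mul_torus_mul_unipotent_inj` gives `n = n′`; then the diagonal of the lower-unitriangular-times-diagonal product `n̄ m` is that of `m`).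
[cite: Casselman1995, Prop. 1.4.4] [cite: BruhatTits1972, (4.4.4)] -/
theorem nbar_torus_unipotent_unique {nb m n nb' m' n' : ↥(unitaryGroupOfForm σ J)}
    (hnb : nb ∈ ((borelTriple σ J hJ).N).map (MulAut.conj (weylLongU σ hJ)).toMonoidHom) (hm : m ∈ (borelTriple σ J hJ).M)
    (hn : n ∈ (borelTriple σ J hJ).N) (hnb' : nb' ∈ ((borelTriple σ J hJ).N).map (MulAut.conj (weylLongU σ hJ)).toMonoidHom)
    (hm' : m' ∈ (borelTriple σ J hJ).M) (hn' : n' ∈ (borelTriple σ J hJ).N) (h : nb * m * n = nb' * m' * n') :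
    nb = nb' ∧ m = m' ∧ n = n' := by
  have hnn : n = n' := nbar_mul_torus_mul_unipotent_inj σ hJ nb hnb m hm n hn nb' hnb' m' hm' n' hn' h
  subst hnn
  have h2 : nb * m = nb' * m' := mul_right_cancel h
  -- the diagonals: `(n̄ m)ᵢᵢ = dᵢ`
  rw [borelTriple_M] at hm hm'
  obtain ⟨d, hd⟩ := (mem_torusU_iff m).1 hm
  obtain ⟨d', hd'⟩ := (mem_torusU_iff m').1 hm'
  have hdiag : ∀ (x mm : ↥(unitaryGroupOfForm σ J)) (e : Fin 3 → Kˣ), x ∈ ((borelTriple σ J hJ).N).map (MulAut.conj (weylLongU σ hJ)).toMonoidHom →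
      glDiagonal 3 K e = (mm : GL (Fin 3) K) → ∀ i, (((x * mm : ↥(unitaryGroupOfForm σ J)) : GL (Fin 3) K) : Matrix (Fin 3) (Fin 3) K) i i = e i := by
    intro x mm e hx he i
    rw [Subgroup.coe_mul, Units.val_mul, ← he, coe_glDiagonal, Matrix.mul_diagonal, apply_diag_eq_one_of_mem_Nbar σ hJ hx, one_mul]
  have hdd : d = d' := by
    funext i
    apply Units.ext
    rw [← hdiag nb m d hnb hd i, ← hdiag nb' m' d' hnb' hd' i, h2]
  have hmm : m = m' := by
    apply Subtype.ext
    rw [← hd, ← hd', hdd]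
  subst hmm
  exact ⟨mul_right_cancel h2, rfl, rfl⟩

/-- **(L4) THE IWAHORI FACTORISATION OF `K_γ ∩ U` IS A BIJECTION** `(K_γ ∩ N̄) × (K_γ ∩ T) × (K_γ ∩ N) → K_γ ∩ U`, `(n̄, m, n) ↦ n̄ m n` (`γ < 1`): surjective by ★
`coe_comap_congruenceGL_eq_mul`, injective by `nbar_torus_unipotent_unique`. [cite: Casselman1995, Prop. 1.4.4] [cite: BruhatTits1972, (4.4.3)–(4.4.4)] -/
theorem bijOn_iwahori_level {γ : ValueGroupWithZero K} (hγ : γ < 1) :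
    Set.BijOn (fun p : ↥(unitaryGroupOfForm σ J) × (↥(unitaryGroupOfForm σ J) × ↥(unitaryGroupOfForm σ J)) => p.1 * p.2.1 * p.2.2)
      ((((congruenceGL 3 γ).comap (unitaryGroupOfForm σ J).subtype ⊓
            ((borelTriple σ J hJ).N).map (MulAut.conj (weylLongU σ hJ)).toMonoidHom : Subgroup ↥(unitaryGroupOfForm σ J)) :
          Set ↥(unitaryGroupOfForm σ J)) ×ˢ
        ((((congruenceGL 3 γ).comap (unitaryGroupOfForm σ J).subtype ⊓ (borelTriple σ J hJ).M : Subgroup ↥(unitaryGroupOfForm σ J)) :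
            Set ↥(unitaryGroupOfForm σ J)) ×ˢ
          (((congruenceGL 3 γ).comap (unitaryGroupOfForm σ J).subtype ⊓ (borelTriple σ J hJ).N : Subgroup ↥(unitaryGroupOfForm σ J)) :
            Set ↥(unitaryGroupOfForm σ J))))
      (((congruenceGL 3 γ).comap (unitaryGroupOfForm σ J).subtype : Subgroup ↥(unitaryGroupOfForm σ J)) : Set ↥(unitaryGroupOfForm σ J)) := by
  refine ⟨?_, ?_, ?_⟩
  · rintro ⟨x, y, z⟩ ⟨hx, hy, hz⟩
    exact Subgroup.mul_mem _ (Subgroup.mul_mem _ (Subgroup.mem_inf.1 hx).1 (Subgroup.mem_inf.1 hy).1) (Subgroup.mem_inf.1 hz).1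
  · rintro ⟨x, y, z⟩ ⟨hx, hy, hz⟩ ⟨x', y', z'⟩ ⟨hx', hy', hz'⟩ h
    obtain ⟨h1, h2, h3⟩ := nbar_torus_unipotent_unique σ hJ (Subgroup.mem_inf.1 hx).2 (Subgroup.mem_inf.1 hy).2 (Subgroup.mem_inf.1 hz).2
      (Subgroup.mem_inf.1 hx').2 (Subgroup.mem_inf.1 hy').2 (Subgroup.mem_inf.1 hz').2 h
    simp only [Prod.mk.injEq]
    exact ⟨h1, h2, h3⟩
  · intro k hk
    have hk' := hk
    rw [coe_comap_congruenceGL_eq_mul σ hJ hγ] at hk'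
    obtain ⟨_, ⟨x, hx, y, hy, rfl⟩, z, hz, rfl⟩ := hk'
    exact ⟨(x, y, z), ⟨hx, hy, hz⟩, rfl⟩

/-- **(L4), `∃!`-form**: every `k ∈ K_γ ∩ U` (`γ < 1`) is `n̄ m n` for a UNIQUE triple `(n̄, m, n) ∈ (K_γ ∩ N̄) × (K_γ ∩ T) × (K_γ ∩ N)`.
[cite: Casselman1995, Prop. 1.4.4] [cite: BruhatTits1972, (4.4.3)–(4.4.4)] -/
theorem existsUnique_iwahori_level {γ : ValueGroupWithZero K} (hγ : γ < 1) {k : ↥(unitaryGroupOfForm σ J)}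
    (hk : k ∈ (congruenceGL 3 γ).comap (unitaryGroupOfForm σ J).subtype) :
    ∃! p : ↥(unitaryGroupOfForm σ J) × (↥(unitaryGroupOfForm σ J) × ↥(unitaryGroupOfForm σ J)),
      (p.1 ∈ (congruenceGL 3 γ).comap (unitaryGroupOfForm σ J).subtype ⊓ ((borelTriple σ J hJ).N).map (MulAut.conj (weylLongU σ hJ)).toMonoidHom ∧
        p.2.1 ∈ (congruenceGL 3 γ).comap (unitaryGroupOfForm σ J).subtype ⊓ (borelTriple σ J hJ).M ∧
        p.2.2 ∈ (congruenceGL 3 γ).comap (unitaryGroupOfForm σ J).subtype ⊓ (borelTriple σ J hJ).N) ∧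
      k = p.1 * p.2.1 * p.2.2 := by
  obtain ⟨p, ⟨hp1, hp2, hp3⟩, hpk⟩ := (bijOn_iwahori_level σ hJ hγ).surjOn hk
  refine ⟨p, ⟨⟨hp1, hp2, hp3⟩, hpk.symm⟩, fun q ⟨⟨hq1, hq2, hq3⟩, hqk⟩ => ?_⟩
  exact (bijOn_iwahori_level σ hJ hγ).injOn ⟨hq1, hq2, hq3⟩ ⟨hp1, hp2, hp3⟩ (hqk.symm.trans hpk.symm)

/-- **Each piece of an `N̄ · T · N` product that lands in `K_γ` lies in `K_γ`** (`γ < 1`): if `n̄ m n ∈ K_γ` with `n̄ ∈ w₀Nw₀`, `m ∈ T`, `n ∈ N` (no level assumed on the pieces),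
then `n̄, m, n ∈ K_γ` — ★ factorisation inside `K_γ` + `nbar_torus_unipotent_unique` (the «independence of the three pieces» used by (J4a)). [cite: Casselman1995, Prop. 1.4.4] -/
theorem mem_level_of_nbar_torus_unipotent_mem {γ : ValueGroupWithZero K} (hγ : γ < 1) {nb m n : ↥(unitaryGroupOfForm σ J)}
    (hnb : nb ∈ ((borelTriple σ J hJ).N).map (MulAut.conj (weylLongU σ hJ)).toMonoidHom) (hm : m ∈ (borelTriple σ J hJ).M)
    (hn : n ∈ (borelTriple σ J hJ).N) (hk : nb * m * n ∈ (congruenceGL 3 γ).comap (unitaryGroupOfForm σ J).subtype) :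
    nb ∈ (congruenceGL 3 γ).comap (unitaryGroupOfForm σ J).subtype ∧ m ∈ (congruenceGL 3 γ).comap (unitaryGroupOfForm σ J).subtype ∧
      n ∈ (congruenceGL 3 γ).comap (unitaryGroupOfForm σ J).subtype := by
  obtain ⟨⟨x, y, z⟩, ⟨hx, hy, hz⟩, hxyz⟩ := (bijOn_iwahori_level σ hJ hγ).surjOn hk
  obtain ⟨h1, h2, h3⟩ := nbar_torus_unipotent_unique σ hJ (Subgroup.mem_inf.1 hx).2 (Subgroup.mem_inf.1 hy).2 (Subgroup.mem_inf.1 hz).2 hnb hm hn hxyz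
  subst h1; subst h2; subst h3
  exact ⟨(Subgroup.mem_inf.1 hx).1, (Subgroup.mem_inf.1 hy).1, (Subgroup.mem_inf.1 hz).1⟩
end Iwahori
/-! ## §4 (L6) Box subgroups of `N` (generic valued ring, as ★ (J3)) -/
section Box
variable {R : Type*} [CommRing R] (σ : R →+* R) (hσ : ∀ x, σ (σ x) = x) {J : Matrix (Fin 3) (Fin 3) R}
  [Invertible (2 : R)] (hJ : J = (StdForm.antidiagonal 3).over R)
  {Γ₀ : Type*} [LinearOrderedCommGroupWithZero Γ₀] (v : Valuation R Γ₀) (hv : ∀ x, v (σ x) = v x)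

include hv in
/-- **(L6) THE BOX `{v(x) ≤ ρx ∧ v(y) ≤ ρy}` IS A SUBGROUP of `N`** as soon as `v(½)·ρx² ≤ ρy` (the commutator cocycle `½(x′σx − xσx′)` of ★ `coe_heisY_mul` has valuation
`≤ v(½)·ρx²`; inverses by ★ `heisX_inv`, `coe_heisY_inv`).  Stated as an existence so that no definition is introduced. [cite: vanDijk1972, §2] [cite: Rogawski1990, §1.10 p. 9] -/
theorem exists_subgroup_box (ρx ρy : Γ₀) (hρ : v (⅟(2 : R)) * (ρx * ρx) ≤ ρy) :
    ∃ H : Subgroup ↥(unipotentU σ J), ∀ n : ↥(unipotentU σ J), n ∈ H ↔ v (heisX σ n) ≤ ρx ∧ v (heisY σ hσ hJ n : R) ≤ ρy := by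
  have hcross : ∀ u w : ↥(unipotentU σ J), v (heisX σ u) ≤ ρx → v (heisX σ w) ≤ ρx →
      v (⅟(2 : R) * (heisX σ w * σ (heisX σ u) - heisX σ u * σ (heisX σ w))) ≤ ρy := by
    intro u w hu hw
    rw [map_mul]
    refine le_trans (mul_le_mul' le_rfl (Valuation.map_sub _ _ _)) ?_
    rw [map_mul, map_mul, hv, hv]
    calc v (⅟(2 : R)) * max (v (heisX σ w) * v (heisX σ u)) (v (heisX σ u) * v (heisX σ w))
        ≤ v (⅟(2 : R)) * (ρx * ρx) := mul_le_mul' le_rfl (max_le (mul_le_mul' hw hu) (mul_le_mul' hu hw))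
      _ ≤ ρy := hρ
  refine ⟨{ carrier := {n | v (heisX σ n) ≤ ρx ∧ v (heisY σ hσ hJ n : R) ≤ ρy}
            mul_mem' := ?_, one_mem' := ?_, inv_mem' := ?_ }, fun n => Iff.rfl⟩
  · rintro u w ⟨hux, huy⟩ ⟨hwx, hwy⟩
    refine ⟨?_, ?_⟩
    · rw [heisX_mul]
      exact le_trans (Valuation.map_add _ _ _) (max_le hux hwx)
    · rw [coe_heisY_mul]
      exact le_trans (Valuation.map_add _ _ _) (max_le (le_trans (Valuation.map_add _ _ _) (max_le huy hwy)) (hcross u w hux hwx))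
  · refine ⟨?_, ?_⟩
    · rw [heisX_one, Valuation.map_zero]; exact zero_le
    · rw [coe_heisY_one, Valuation.map_zero]; exact zero_le
  · rintro u ⟨hux, huy⟩
    refine ⟨?_, ?_⟩
    · rw [heisX_inv, Valuation.map_neg]; exact hux
    · rw [coe_heisY_inv, Valuation.map_neg]; exact huy
end Box
/-! ## §5 (L7) The Haar measure of a box under the regular twist `ψ_t(n) = (t⁻¹ n t) n⁻¹` -/
section Haar
variable {R : Type*} [CommRing R] [TopologicalSpace R] [IsTopologicalRing R] (σ : R →+* R) (hσ : ∀ x, σ (σ x) = x)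
  (hσc : Continuous σ) [Invertible (2 : R)] {J : Matrix (Fin 3) (Fin 3) R} (hJ : J = (StdForm.antidiagonal 3).over R)
  [LocallyCompactSpace R] [T2Space R] [SecondCountableTopology R] [MeasurableSpace R] [BorelSpace R]
  [MeasurableSpace ↥(unipotentU σ J)] [BorelSpace ↥(unipotentU σ J)]

include hσ hJ in
/-- **(L7, image form) THE REGULAR TWIST SCALES HAAR MEASURE OF SETS BY `‖a−1‖_R·χ⁻(b−1)`**: for every Haar measure `μ_N` of `N`, every REGULAR `t = diag(d) ∈ T` and every `S ⊆ N`
with measurable image, `μ_N (ψ_t '' S) = ‖a−1‖_R·χ⁻(b−1) · μ_N S` (★ Haar MODULE `map_torusConj_mul_inv_eq_smul` + injectivity of `ψ_t`, ★ `injOn_vanDijk`).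
[cite: vanDijk1972, §2] [cite: HarishChandra1970, Lemma 22] [cite: Rogawski1990, §12.5 p. 182] -/
theorem measure_image_vanDijk (μN : Measure ↥(unipotentU σ J)) [μN.IsHaarMeasure] (t : ↥(torusU σ J)) {d : Fin 3 → Rˣ}
    (hd : glDiagonal 3 R d = ((t : ↥(unitaryGroupOfForm σ J)) : GL (Fin 3) R))
    (hreg : IsRegularElt ((t : ↥(unitaryGroupOfForm σ J)) : GL (Fin 3) R))
    (S : Set ↥(unipotentU σ J)) (hS : MeasurableSet ((fun n : ↥(unipotentU σ J) => torusConj σ t n * n⁻¹) '' S)) :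
    μN ((fun n : ↥(unipotentU σ J) => torusConj σ t n * n⁻¹) '' S) =
      ((distribHaarChar R (isUnit_rootA_sub_one σ t hd hreg).unit *
          skewModulus σ hσc (isUnit_rootB_sub_one σ t hd hreg).unit
            (map_unit_torusCentralScalar_sub_one σ hJ t hd (isUnit_rootB_sub_one σ t hd hreg)) : ℝ≥0) : ℝ≥0∞) * μN S := by
  set ψ : ↥(unipotentU σ J) → ↥(unipotentU σ J) := fun n => torusConj σ t n * n⁻¹ with hψ
  set c : ℝ≥0 := distribHaarChar R (isUnit_rootA_sub_one σ t hd hreg).unit *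
      skewModulus σ hσc (isUnit_rootB_sub_one σ t hd hreg).unit
        (map_unit_torusCentralScalar_sub_one σ hJ t hd (isUnit_rootB_sub_one σ t hd hreg)) with hc
  have hc0 : c ≠ 0 := by
    rw [hc]
    exact mul_ne_zero distribHaarChar_pos.ne' (skewModulus_pos σ hσc _ _).ne'
  have hmap := map_torusConj_mul_inv_eq_smul σ hσ hσc hJ μN t hd (isUnit_rootA_sub_one σ t hd hreg) (isUnit_rootB_sub_one σ t hd hreg)
  have hinj : Function.Injective ψ := fun a b h => injOn_vanDijk σ hσ hJ t hreg Set.univ (Set.mem_univ a) (Set.mem_univ b) h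
  have hmeas : Measurable ψ := (continuous_torusConj_mul_inv σ t).measurable
  have key : μN S = ((c⁻¹ : ℝ≥0) : ℝ≥0∞) * μN (ψ '' S) := by
    have h1 : (μN.map ψ) (ψ '' S) = μN S := by
      rw [Measure.map_apply hmeas hS, Set.preimage_image_eq S hinj]
    rw [← h1, hmap, Measure.smul_apply, hc, mul_inv]
    rfl
  rw [key, ← mul_assoc, ← ENNReal.coe_mul, mul_inv_cancel₀ hc0, ENNReal.coe_one, one_mul]

variable {Γ₀ : Type*} [LinearOrderedCommGroupWithZero Γ₀] (v : Valuation R Γ₀) (hv : ∀ x, v (σ x) = v x)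

include hv in
/-- **(L7) THE HAAR MEASURE OF A TWISTED BOX**: for every Haar measure `μ_N` of `N`, every REGULAR `t = diag(d)`, radii `ρx ρy` satisfying (J3)'s depth condition
`v(½)·v(a − σa)·ρx² ≤ v(b−1)·ρy`, and provided the target box is measurable: `μ_N (BOX(v(a−1)ρx, v(b−1)ρy)) = ‖a−1‖_R·χ⁻(b−1) · μ_N (BOX(ρx, ρy))`
(★ (J3) `bijOn_vanDijk_box`: the target box IS `ψ_t '' BOX(ρx, ρy)`; then `measure_image_vanDijk`). [cite: vanDijk1972, §2] [cite: HarishChandra1970, Lemma 22] -/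
theorem measure_vanDijk_box (μN : Measure ↥(unipotentU σ J)) [μN.IsHaarMeasure] (t : ↥(torusU σ J)) {d : Fin 3 → Rˣ}
    (hd : glDiagonal 3 R d = ((t : ↥(unitaryGroupOfForm σ J)) : GL (Fin 3) R))
    (hreg : IsRegularElt ((t : ↥(unitaryGroupOfForm σ J)) : GL (Fin 3) R)) {ρx ρy : Γ₀}
    (hρ : v (⅟(2 : R)) * v ((((d 0)⁻¹ * d 1 : Rˣ) : R) - σ (((d 0)⁻¹ * d 1 : Rˣ) : R)) * (ρx * ρx) ≤ v ((((d 0)⁻¹ * d 2 : Rˣ) : R) - 1) * ρy)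
    (hmeas : MeasurableSet {n : ↥(unipotentU σ J) | v (heisX σ n) ≤ v ((((d 0)⁻¹ * d 1 : Rˣ) : R) - 1) * ρx ∧
      v (heisY σ hσ hJ n : R) ≤ v ((((d 0)⁻¹ * d 2 : Rˣ) : R) - 1) * ρy}) :
    μN {n : ↥(unipotentU σ J) | v (heisX σ n) ≤ v ((((d 0)⁻¹ * d 1 : Rˣ) : R) - 1) * ρx ∧ v (heisY σ hσ hJ n : R) ≤ v ((((d 0)⁻¹ * d 2 : Rˣ) : R) - 1) * ρy} =
      ((distribHaarChar R (isUnit_rootA_sub_one σ t hd hreg).unit *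
          skewModulus σ hσc (isUnit_rootB_sub_one σ t hd hreg).unit
            (map_unit_torusCentralScalar_sub_one σ hJ t hd (isUnit_rootB_sub_one σ t hd hreg)) : ℝ≥0) : ℝ≥0∞) *
        μN {n : ↥(unipotentU σ J) | v (heisX σ n) ≤ ρx ∧ v (heisY σ hσ hJ n : R) ≤ ρy} := by
  have himage := (bijOn_vanDijk_box σ hσ hJ v hv t hreg hd hρ).image_eq
  rw [← himage] at hmeas ⊢
  exact measure_image_vanDijk σ hσ hσc hJ μN t hd hreg _ hmeas

omit [LocallyCompactSpace R] [T2Space R] [SecondCountableTopology R] [MeasurableSpace R] [BorelSpace R] in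
include hσc in
/-- **Boxes are closed, hence measurable, whenever the valuation balls of `R` are closed** (`hball`; automatic on a valued field such as the model `K = L_w`, where they are clopen):
`heisX`, `heisY` are continuous (★ `continuous_heisX`, ★ `continuous_heisY`). Discharges the `MeasurableSet` hypothesis of `measure_vanDijk_box` there. [cite: vanDijk1972, §2] -/
theorem measurableSet_box (hball : ∀ r : Γ₀, IsClosed {x : R | v x ≤ r}) (ρx ρy : Γ₀) :
    MeasurableSet {n : ↥(unipotentU σ J) | v (heisX σ n) ≤ ρx ∧ v (heisY σ hσ hJ n : R) ≤ ρy} :=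
  (((hball ρx).preimage (continuous_heisX σ (J := J))).inter
    ((hball ρy).preimage (continuous_subtype_val.comp (continuous_heisY σ hσ hσc hJ)))).measurableSet
end Haar
end Summit.HodgeConjecture.HodgeConjecture.Cruxes.H413.F0P3cStCharTSLevelBoxes

end
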